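import Literature.NumberTheory.Automorphic.LevelActionCoefficientChange
import HarnessLib

/-!
# Sections of the coefficients-at-`p` local systems: the non-canonical trivialisation and the
# exactness of the change of coefficients

Topic `NumberTheory/Automorphic`; namespace `Literature.NumberTheory.Automorphic.LevelAction`;
definitions with bodies and theorems, no named fact, no instance, no `sorry`.  Universe `0` (as
`LevelActionTwoLevelHecke`).

For the integral "coefficients at `p`" model `M(W, τ) = sections Δ τ W = {f : 𝒢 → V | τ(u) f(g u)
= f(g), u ∈ W}` (`IntegralWeightHeckeModuleGL2`) of the local system of a `W`-module `V` on the
arithmetic quotients of level `W`: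

* `sectionsToFun` / `funToSections` / `sectionsEquivFun` — **`M(W, τ) ≅ Fun(𝒢/W, V)` as
  `R`-modules** (evaluate at the chosen representatives `c.out` of the cosets; inverse
  `F ↦ (g ↦ τ(g⁻¹ (gW)~) F(gW))`).  NOT `Γ`-equivariant (the representatives are not
  `Γ`-stable) but natural in the coefficients (`sectionsToFun_pushforward`): it reduces exactness
  questions about `M(W, -)` to functions.
* `pushforward_injective`, `pushforward_surjective`, `pushforward_exact`,
  **`shortExact_pushforward`** — **the change of coefficients `M(W, τ) → M(W, τ')` along an
  equivariant `φ : V → V'` (`LevelAction.pushforward`) is exact**: an injective / surjective /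
  exact sequence `0 → V₁ → V₂ → V₃ → 0` of `W`-modules gives a SHORT EXACT sequence
  `0 → M(W, τ₁) → M(W, τ₂) → M(W, τ₃) → 0` of `Γ`-representations (Mathlib `ShortExact` in
  `Rep R Γ`), ready for the long exact sequence of `groupCohomology` — the exactness of the
  functor "sections" used throughout the finite-level control of the ordinary cohomology
  ([KhareThorne2017, §6.3]; [Hida1993Duke, §5]).

## References

* H. Hida, Ann. Inst. Fourier 44 (1994), §1 (the coefficients-at-`p` local systems). [Hida1994AIF]
* C. Khare, J. A. Thorne, Amer. J. Math. 139 (2017), §6.3. [KhareThorne2017]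
-/

noncomputable section

open CategoryTheory

namespace Literature.NumberTheory.Automorphic

namespace LevelAction

variable {R : Type} [CommRing R] {Γ 𝒢 : Type} [Group Γ] [Group 𝒢] (ι : Γ →* 𝒢)
  (Δ : Submonoid 𝒢) {V V' V'' : Type} [AddCommGroup V] [Module R V] [AddCommGroup V']
  [Module R V'] [AddCommGroup V''] [Module R V''] (τ : Δ →* Module.End R V)
  (τ' : Δ →* Module.End R V') (τ'' : Δ →* Module.End R V'') (W : Subgroup 𝒢)

/-! ### The representative correction `g⁻¹ (gW)~ ∈ W` -/

/-- For `g ∈ 𝒢`, the element `g⁻¹ · (gW).out ∈ W` correcting `g` to the chosen representative of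
its coset. [folklore] -/
theorem inv_mul_out_mem (g : 𝒢) : g⁻¹ * ((g : 𝒢 ⧸ W)).out ∈ W := by
  rw [← QuotientGroup.eq, QuotientGroup.out_eq']

variable {W} in
/-- The correction of `g u` is `u⁻¹` times the correction of `g` (`u ∈ W`). [folklore] -/
theorem inv_mul_out_mul (g : 𝒢) {u : 𝒢} (hu : u ∈ W) :
    (g * u)⁻¹ * (((g * u : 𝒢) : 𝒢 ⧸ W)).out = u⁻¹ * (g⁻¹ * ((g : 𝒢 ⧸ W)).out) := by
  have h : ((g * u : 𝒢) : 𝒢 ⧸ W) = (g : 𝒢 ⧸ W) := by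
    rw [QuotientGroup.eq]
    simpa using W.inv_mem hu
  rw [h, mul_inv_rev, mul_assoc]

/-! ### `M(W, τ) ≅ Fun(𝒢/W, V)` -/

/-- Evaluation of sections at the chosen coset representatives: `f ↦ (c ↦ f(c.out))`. [folklore] -/
def sectionsToFun : sections Δ τ W →ₗ[R] (𝒢 ⧸ W → V) where
  toFun f c := (f : 𝒢 → V) c.out
  map_add' _ _ := rfl
  map_smul' _ _ := rfl

/-- Unfolding `sectionsToFun`. [folklore] -/
@[simp]
theorem sectionsToFun_apply (f : sections Δ τ W) (c : 𝒢 ⧸ W) :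
    sectionsToFun Δ τ W f c = (f : 𝒢 → V) c.out :=
  rfl

variable {Δ W}

/-- The function `g ↦ τ(g⁻¹ (gW)~) F(gW)` attached to `F : 𝒢/W → V` (for `W ⊆ Δ`). [folklore] -/
def funToSectionsFun (hW : W.toSubmonoid ≤ Δ) (F : 𝒢 ⧸ W → V) (g : 𝒢) : V :=
  τ ⟨g⁻¹ * ((g : 𝒢 ⧸ W)).out, hW (inv_mul_out_mem W g)⟩ (F (g : 𝒢 ⧸ W))

/-- `funToSectionsFun F` is a section. [folklore] -/
theorem funToSectionsFun_mem_sections (hW : W.toSubmonoid ≤ Δ) (F : 𝒢 ⧸ W → V) :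
    funToSectionsFun τ hW F ∈ sections Δ τ W := by
  rw [mem_sections_iff hW]
  intro g u hu
  simp only [funToSectionsFun]
  have hcoset : ((g * u : 𝒢) : 𝒢 ⧸ W) = (g : 𝒢 ⧸ W) := by
    rw [QuotientGroup.eq]; simpa using W.inv_mem hu
  have hel : (⟨u, hW hu⟩ : Δ) * ⟨(g * u)⁻¹ * (((g * u : 𝒢) : 𝒢 ⧸ W)).out,
      hW (inv_mul_out_mem W (g * u))⟩ = ⟨g⁻¹ * ((g : 𝒢 ⧸ W)).out, hW (inv_mul_out_mem W g)⟩ := by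
    refine Subtype.ext ?_
    change u * ((g * u)⁻¹ * (((g * u : 𝒢) : 𝒢 ⧸ W)).out) = g⁻¹ * ((g : 𝒢 ⧸ W)).out
    rw [inv_mul_out_mul g hu, mul_inv_cancel_left]
  rw [← Module.End.mul_apply, ← map_mul, hel, hcoset]

/-- The inverse trivialisation `Fun(𝒢/W, V) → M(W, τ)`, `F ↦ (g ↦ τ(g⁻¹ (gW)~) F(gW))`. [folklore] -/
def funToSections (hW : W.toSubmonoid ≤ Δ) : (𝒢 ⧸ W → V) →ₗ[R] sections Δ τ W where
  toFun F := ⟨funToSectionsFun τ hW F, funToSectionsFun_mem_sections τ hW F⟩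
  map_add' F F' := Subtype.ext (funext fun g => by
    simp only [funToSectionsFun, Pi.add_apply, map_add, Submodule.coe_add])
  map_smul' c F := Subtype.ext (funext fun g => by
    simp only [funToSectionsFun, Pi.smul_apply, map_smul, RingHom.id_apply, Submodule.coe_smul])

/-- Unfolding `funToSections`. [folklore] -/
theorem coe_funToSections_apply (hW : W.toSubmonoid ≤ Δ) (F : 𝒢 ⧸ W → V) (g : 𝒢) :
    (funToSections τ hW F : 𝒢 → V) g =
      τ ⟨g⁻¹ * ((g : 𝒢 ⧸ W)).out, hW (inv_mul_out_mem W g)⟩ (F (g : 𝒢 ⧸ W)) :=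
  rfl

/-- `sectionsToFun ∘ funToSections = id`: at a representative the correction is `1`. [folklore] -/
theorem sectionsToFun_funToSections (hW : W.toSubmonoid ≤ Δ) (F : 𝒢 ⧸ W → V) :
    sectionsToFun Δ τ W (funToSections τ hW F) = F := by
  funext c
  rw [sectionsToFun_apply, coe_funToSections_apply]
  have hel : (⟨c.out⁻¹ * ((c.out : 𝒢 ⧸ W)).out, hW (inv_mul_out_mem W c.out)⟩ : Δ) = 1 := by
    refine Subtype.ext ?_
    change c.out⁻¹ * ((c.out : 𝒢 ⧸ W)).out = 1
    rw [QuotientGroup.out_eq', inv_mul_cancel]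
  rw [hel, map_one, Module.End.one_apply, QuotientGroup.out_eq']

/-- `funToSections ∘ sectionsToFun = id`: a section is determined by its values at the
representatives, `f(g) = τ(g⁻¹ (gW)~) f((gW)~)`. [folklore] -/
theorem funToSections_sectionsToFun (hW : W.toSubmonoid ≤ Δ) (f : sections Δ τ W) :
    funToSections τ hW (sectionsToFun Δ τ W f) = f := by
  refine Subtype.ext (funext fun g => ?_)
  rw [coe_funToSections_apply, sectionsToFun_apply]
  have h := (mem_sections_iff hW).1 f.2 g (g⁻¹ * ((g : 𝒢 ⧸ W)).out) (inv_mul_out_mem W g)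
  rwa [mul_inv_cancel_left] at h

variable (Δ W) in
/-- **`M(W, τ) ≅ Fun(𝒢/W, V)`** as `R`-modules (non-canonical: depends on the chosen
representatives; not `Γ`-equivariant). [folklore] -/
def sectionsEquivFun (hW : W.toSubmonoid ≤ Δ) : sections Δ τ W ≃ₗ[R] (𝒢 ⧸ W → V) :=
  { sectionsToFun Δ τ W with
    invFun := funToSections τ hW
    left_inv := funToSections_sectionsToFun τ hW
    right_inv := sectionsToFun_funToSections τ hW }

/-- Unfolding `sectionsEquivFun`. [folklore] -/
@[simp]
theorem sectionsEquivFun_apply (hW : W.toSubmonoid ≤ Δ) (f : sections Δ τ W) (c : 𝒢 ⧸ W) :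
    sectionsEquivFun Δ τ W hW f c = (f : 𝒢 → V) c.out :=
  rfl

/-- **Naturality in the coefficients**: for an equivariant `φ : V → V'`, evaluating at the
representatives commutes with `φ ∘ -`. [folklore] -/
theorem sectionsToFun_pushforward (φ : V →ₗ[R] V') (hφ : ∀ δ : Δ, φ ∘ₗ τ δ = τ' δ ∘ₗ φ)
    (f : sections Δ τ W) :
    sectionsToFun Δ τ' W ((pushforward ι Δ τ τ' W φ hφ).hom f) = φ ∘ sectionsToFun Δ τ W f :=
  rfl

/-! ### Exactness of the change of coefficients -/

/-- **`M(W, φ)` is injective for `φ` injective.** [folklore] -/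
theorem pushforward_injective (φ : V →ₗ[R] V') (hφ : ∀ δ : Δ, φ ∘ₗ τ δ = τ' δ ∘ₗ φ)
    (hinj : Function.Injective φ) : Function.Injective (pushforward ι Δ τ τ' W φ hφ).hom := by
  intro f f' h
  refine Subtype.ext (funext fun g => hinj ?_)
  have h' : ((pushforward ι Δ τ τ' W φ hφ).hom f : 𝒢 → V') g =
      ((pushforward ι Δ τ τ' W φ hφ).hom f' : 𝒢 → V') g := by rw [h]
  exact h'

/-- **`M(W, φ)` is surjective for `φ` surjective** (`W ⊆ Δ`): lift the values at the
representatives and spread out by `funToSections`. [folklore] -/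
theorem pushforward_surjective (hW : W.toSubmonoid ≤ Δ) (φ : V →ₗ[R] V')
    (hφ : ∀ δ : Δ, φ ∘ₗ τ δ = τ' δ ∘ₗ φ) (hsurj : Function.Surjective φ) :
    Function.Surjective (pushforward ι Δ τ τ' W φ hφ).hom := by
  intro f'
  choose pre hpre using hsurj
  refine ⟨funToSections τ hW (fun c => pre (sectionsToFun Δ τ' W f' c)), ?_⟩
  apply (sectionsEquivFun Δ τ' W hW).injective
  change sectionsToFun Δ τ' W _ = sectionsToFun Δ τ' W f'
  rw [sectionsToFun_pushforward]
  funext c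
  rw [Function.comp_apply, sectionsToFun_apply, coe_funToSections_apply]
  have hφτ : ∀ (δ : Δ) (v : V), φ (τ δ v) = τ' δ (φ v) := fun δ v => LinearMap.congr_fun (hφ δ) v
  rw [hφτ, hpre]
  -- `τ'(out⁻¹ (out W)~) f'(out) = f'(out)` since `out⁻¹ (out W)~ = 1`
  have hel : (⟨c.out⁻¹ * ((c.out : 𝒢 ⧸ W)).out, hW (inv_mul_out_mem W c.out)⟩ : Δ) = 1 := by
    refine Subtype.ext ?_
    change c.out⁻¹ * ((c.out : 𝒢 ⧸ W)).out = 1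
    rw [QuotientGroup.out_eq', inv_mul_cancel]
  rw [hel, map_one, Module.End.one_apply, QuotientGroup.out_eq']

/-- **`M(W, -)` is exact in the middle** (`W ⊆ Δ`): if `ker ψ = range φ` on the coefficients then
`ker M(W, ψ) = range M(W, φ)` on sections. [folklore] -/
theorem pushforward_exact (hW : W.toSubmonoid ≤ Δ) (φ : V →ₗ[R] V') (ψ : V' →ₗ[R] V'')
    (hφ : ∀ δ : Δ, φ ∘ₗ τ δ = τ' δ ∘ₗ φ) (hψ : ∀ δ : Δ, ψ ∘ₗ τ' δ = τ'' δ ∘ₗ ψ)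
    (hex : Function.Exact φ ψ) (f' : sections Δ τ' W)
    (hf' : (pushforward ι Δ τ' τ'' W ψ hψ).hom f' = 0) :
    ∃ f : sections Δ τ W, (pushforward ι Δ τ τ' W φ hφ).hom f = f' := by
  -- pointwise preimages of the values at the representatives
  have hval : ∀ c : 𝒢 ⧸ W, ∃ v : V, φ v = sectionsToFun Δ τ' W f' c := fun c => by
    refine (hex _).1 ?_
    have h : ((pushforward ι Δ τ' τ'' W ψ hψ).hom f' : 𝒢 → V'') c.out = 0 := by
      rw [hf']; rfl
    exact h
  choose pre hpre using hval
  refine ⟨funToSections τ hW pre, ?_⟩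
  apply (sectionsEquivFun Δ τ' W hW).injective
  change sectionsToFun Δ τ' W _ = sectionsToFun Δ τ' W f'
  rw [sectionsToFun_pushforward]
  funext c
  rw [Function.comp_apply, sectionsToFun_apply, coe_funToSections_apply]
  have hφτ : ∀ (δ : Δ) (v : V), φ (τ δ v) = τ' δ (φ v) := fun δ v => LinearMap.congr_fun (hφ δ) v
  rw [hφτ, hpre]
  have hel : (⟨c.out⁻¹ * ((c.out : 𝒢 ⧸ W)).out, hW (inv_mul_out_mem W c.out)⟩ : Δ) = 1 := by
    refine Subtype.ext ?_
    change c.out⁻¹ * ((c.out : 𝒢 ⧸ W)).out = 1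
    rw [QuotientGroup.out_eq', inv_mul_cancel]
  rw [hel, map_one, Module.End.one_apply, QuotientGroup.out_eq', sectionsToFun_apply]

/-- `M(W, φ) ≫ M(W, ψ) = M(W, ψ ∘ φ)`-type vanishing: if `ψ ∘ φ = 0` then the composite of the
push-forwards is zero. [folklore] -/
theorem pushforward_comp_pushforward_eq_zero (φ : V →ₗ[R] V') (ψ : V' →ₗ[R] V'')
    (hφ : ∀ δ : Δ, φ ∘ₗ τ δ = τ' δ ∘ₗ φ) (hψ : ∀ δ : Δ, ψ ∘ₗ τ' δ = τ'' δ ∘ₗ ψ)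
    (h0 : ψ ∘ₗ φ = 0) :
    pushforward ι Δ τ τ' W φ hφ ≫ pushforward ι Δ τ' τ'' W ψ hψ = 0 := by
  refine Rep.hom_ext (Representation.IntertwiningMap.ext (LinearMap.ext fun f => Subtype.ext
    (funext fun g => ?_)))
  change ψ (φ ((f : 𝒢 → V) g)) = 0
  rw [← LinearMap.comp_apply, h0, LinearMap.zero_apply]

/-- **`0 → M(W, τ) → M(W, τ') → M(W, τ'') → 0` is short exact in `Rep R Γ`** for a short exact
sequence of coefficient modules `0 → V →φ→ V' →ψ→ V'' → 0` with equivariant maps (`W ⊆ Δ`):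
the exactness of the functor "sections of the coefficients-at-`p` local system", ready for the
long exact sequence of group cohomology. [cite: KhareThorne2017, §6.3] [cite: Hida1994AIF, §1] -/
theorem shortExact_pushforward (hW : W.toSubmonoid ≤ Δ) (φ : V →ₗ[R] V') (ψ : V' →ₗ[R] V'')
    (hφ : ∀ δ : Δ, φ ∘ₗ τ δ = τ' δ ∘ₗ φ) (hψ : ∀ δ : Δ, ψ ∘ₗ τ' δ = τ'' δ ∘ₗ ψ)
    (hinj : Function.Injective φ) (hsurj : Function.Surjective ψ) (hex : Function.Exact φ ψ) :
    (ShortComplex.mk (pushforward ι Δ τ τ' W φ hφ) (pushforward ι Δ τ' τ'' W ψ hψ)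
      (pushforward_comp_pushforward_eq_zero ι τ τ' τ'' φ ψ hφ hψ
        (LinearMap.ext fun v => (hex (φ v)).2 ⟨v, rfl⟩))).ShortExact where
  exact := (forget₂ (Rep R Γ) (ModuleCat R)).reflects_exact_of_faithful _ <|
    (ShortComplex.moduleCat_exact_iff _).2 fun f' hf' =>
      pushforward_exact ι τ τ' τ'' hW φ ψ hφ hψ hex f' hf'
  mono_f := (Rep.mono_iff_injective _).2 (pushforward_injective ι τ τ' φ hφ hinj)
  epi_g := (Rep.epi_iff_surjective _).2 (pushforward_surjective ι τ' τ'' hW ψ hψ hsurj)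

end LevelAction

end Literature.NumberTheory.Automorphic
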